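import Mathlib.CategoryTheory.Galois.Decomposition
import HarnessLib

/-!
# Galois towers in a Galois category ([SemiAnbd] §3 p. 38; [SGA1] V §4–5)

[SemiAnbd] §3 p. 38: "if `{𝒢_i → 𝒢}` is a countable collection of connected finite étale Galois
coverings, cofinal among all connected finite étale coverings … we may choose compatible maps
`𝒢_{∞,j} → 𝒢_{∞,i}` … and define `π₁^temp(𝒢) := lim_i Gal(𝒢_{∞,i}/𝒢)`".  The Galois-category
input (Mathlib `GaloisCategory`, [SGA1] V §4–5): from ANY sequence `X : ℕ → C` of objects with
nonempty fibres one can choose a *tower* of connected Galois objects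
`A 0 ⟵ A 1 ⟵ A 2 ⟵ ⋯` with maps `A n ⟶ X n` (so that the `A n` are cofinal as soon as the `X n`
are); `A (n+1)` is a Galois object dominating `A n × X (n+1)`.

Main definitions: `galoisTower F X hX : ℕ → C`, `galoisTowerMap` (`A (n+1) ⟶ A n`),
`galoisTowerToX` (`A n ⟶ X n`), `isGalois_galoisTower`, `galoisTowerMapLE` (`A m ⟶ A n`, `n ≤ m`).
-/

namespace Literature.AnabelianGeometry.Anabelioids

open CategoryTheory CategoryTheory.Limits CategoryTheory.PreGaloisCategory

universe w v u

variable {C : Type u} [Category.{v} C] [GaloisCategory C] (F : C ⥤ FintypeCat.{w}) [FiberFunctor F]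
  (X : ℕ → C) (hX : ∀ n, Nonempty (F.obj (X n)))

/-- The pair `(A, Y)` as a `Bool`-indexed family (for the product `A × Y = ∏ pair`).
[cite: SGA1, Exp. V §4 (Galois objects)] -/
private def pair (A Y : C) : Bool → C := fun b => bif b then A else Y

/-- One step of the tower: a Galois object dominating `A × Y`.  [cite: SGA1, Exp. V §4 (Galois objects)] -/
private theorem step_exists (A Y : C) [IsGalois A] (hY : Nonempty (F.obj Y)) :
    ∃ (B : C) (_ : B ⟶ ∏ᶜ pair A Y), IsGalois B := by
  haveI : ∀ b, Nonempty (F.obj (pair A Y b)) := fun b => by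
    cases b
    · exact hY
    · exact nonempty_fiber_of_isConnected F A
  exact exists_hom_from_galois_of_fiber_nonempty F _ (nonempty_fiber_pi_of_nonempty_of_finite F _)

/-- The tower with its Galois witnesses: `A 0` dominates `X 0`, `A (n+1)` dominates `A n × X (n+1)`.
[cite: MochizukiSemiAnbd2006, Prop 3.6 p.38] -/
private noncomputable def towerAux : ℕ → Σ' (A : C), IsGalois A
  | 0 => ⟨(exists_hom_from_galois_of_fiber_nonempty F (X 0) (hX 0)).choose,
      (exists_hom_from_galois_of_fiber_nonempty F (X 0) (hX 0)).choose_spec.choose_spec⟩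
  | n + 1 =>
      haveI := (towerAux n).2
      ⟨(step_exists F (towerAux n).1 (X (n + 1)) (hX (n + 1))).choose,
        (step_exists F (towerAux n).1 (X (n + 1)) (hX (n + 1))).choose_spec.choose_spec⟩

/-- **A Galois tower over a sequence of objects** `X : ℕ → C` (with nonempty fibres) of a Galois
category: connected Galois objects `A n` ([SemiAnbd] p. 38 "cofinal collection of connected finite
étale Galois coverings … with compatible maps"). [cite: MochizukiSemiAnbd2006, Prop 3.6 p.38] -/
noncomputable def galoisTower (n : ℕ) : C := (towerAux F X hX n).1

/-- The objects of the tower are Galois. [cite: MochizukiSemiAnbd2006, Prop 3.6 p.38] -/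
instance isGalois_galoisTower (n : ℕ) : IsGalois (galoisTower F X hX n) := (towerAux F X hX n).2

/-- The transition map `A (n+1) ⟶ A n` of the tower. [cite: MochizukiSemiAnbd2006, Prop 3.6 p.38] -/
noncomputable def galoisTowerMap (n : ℕ) : galoisTower F X hX (n + 1) ⟶ galoisTower F X hX n :=
  haveI := (towerAux F X hX n).2
  (step_exists F (towerAux F X hX n).1 (X (n + 1)) (hX (n + 1))).choose_spec.choose ≫
    Pi.π (pair (towerAux F X hX n).1 (X (n + 1))) true

/-- The domination map `A n ⟶ X n`. [cite: MochizukiSemiAnbd2006, Prop 3.6 p.38] -/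
noncomputable def galoisTowerToX : ∀ n : ℕ, galoisTower F X hX n ⟶ X n
  | 0 => (exists_hom_from_galois_of_fiber_nonempty F (X 0) (hX 0)).choose_spec.choose
  | n + 1 =>
      haveI := (towerAux F X hX n).2
      (step_exists F (towerAux F X hX n).1 (X (n + 1)) (hX (n + 1))).choose_spec.choose ≫
        Pi.π (pair (towerAux F X hX n).1 (X (n + 1))) false

/-- The composite transition map `A m ⟶ A n` for `n ≤ m` (by recursion on `m - n`).
[cite: MochizukiSemiAnbd2006, Prop 3.6 p.38] -/
noncomputable def galoisTowerMapLE : ∀ {n m : ℕ}, n ≤ m → (galoisTower F X hX m ⟶ galoisTower F X hX n)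
  | n, m, h =>
    if hnm : n = m then eqToHom (by rw [hnm]) else
      have : n ≤ m - 1 := by omega
      have hm : m - 1 + 1 = m := by omega
      eqToHom (by rw [hm]) ≫ galoisTowerMap F X hX (m - 1) ≫ galoisTowerMapLE this
  termination_by n m _ => m - n
  decreasing_by omega

/-- Every object dominated by some `X n` is dominated by the tower: if `X n ⟶ Y` then `A n ⟶ Y`.
[cite: MochizukiSemiAnbd2006, Prop 3.6 p.38] -/
theorem galoisTower_dominates {Y : C} (n : ℕ) (f : X n ⟶ Y) :
    Nonempty (galoisTower F X hX n ⟶ Y) :=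
  ⟨galoisTowerToX F X hX n ≫ f⟩

/-- Every connected object receiving a map from a Galois object `A` receives a SURJECTIVE-on-fibres
map; in particular morphisms from the tower to connected objects are epimorphisms.
[cite: SGA1, Exp. V §4 (connected objects)] -/
theorem epi_of_galoisTower_hom {Y : C} [IsConnected Y] (n : ℕ) (f : galoisTower F X hX n ⟶ Y) :
    Epi f :=
  epi_of_nonempty_of_isConnected F f

end Literature.AnabelianGeometry.Anabelioids
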